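import Summits.FinalStateConjecture.FinalStateConjecture.Theorems.UniformPhotonSphereChannelsR.Negative.FarFrozenPackets
import Summits.FinalStateConjecture.FinalStateConjecture.Theorems.PhotonSphereChannelsExteriorEnergyRW
import Summits.FinalStateConjecture.FinalStateConjecture.Theorems.PhotonSphereChannelsEnergyInequalities

/-!
# Route PhotonSphereChannels · K1R — far-edge frozen packets through the two-ended channel

Negative-side support for item stmt-FinalStateConjecture-14074 (cdisprove seat): the far-edge
frozen velocity packets of `FarFrozenPackets` have arbitrarily small two-ended CHANNEL energy at
every ball radius `ρ ≥ 0` (`far_frozen_channel_small`), so any channel inequality at `(ρ, ℓ)`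
forces the `t`-polynomial kernel to absorb them.  No definitions are introduced.
-/

noncomputable section

open Set Filter MeasureTheory Topology Function

namespace Summit.FinalStateConjecture.FinalStateConjecture.Theorems.FrozenPacket

/-! ### The far-edge packets through the two-ended channel -/

section Channel

open Literature.Geometry.Lorentzian Literature.Geometry.Lorentzian.ReggeWheeler
open scoped ENNReal

/-- Channel energies are dominated by the exterior energy at any time beyond which the exterior
energy is monotone (the liminf along `atTop`/`atBot` is eventually below it). -/
theorem channelEnergy_le_of_antitone' {V : ℝ → ℝ} {xc ρ : ℝ} {ψ : ℝ → ℝ → ℝ}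
    (h : AntitoneOn (exteriorEnergy V xc ρ ψ) (Ici 0) ∧ MonotoneOn (exteriorEnergy V xc ρ ψ) (Iic 0))
    {t₁ : ℝ} (ht₁ : 0 ≤ t₁) :
    channelEnergy V xc ρ ψ atTop ≤ exteriorEnergy V xc ρ ψ t₁ ∧
      channelEnergy V xc ρ ψ atBot ≤ exteriorEnergy V xc ρ ψ (-t₁) := by
  constructor
  · refine liminf_le_of_frequently_le' (Eventually.frequently ?_)
    filter_upwards [eventually_ge_atTop t₁] with t ht
    exact h.1 (mem_Ici.2 ht₁) (mem_Ici.2 (ht₁.trans ht)) ht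
  · refine liminf_le_of_frequently_le' (Eventually.frequently ?_)
    filter_upwards [eventually_le_atBot (-t₁)] with t ht
    exact h.2 (mem_Iic.2 (ht.trans (by linarith))) (mem_Iic.2 (by linarith)) ht

/-- **From the far-side integral to the two-ended exterior energy.** For `ρ ≥ 0` and a `C²` field
vanishing outside the domain of influence of `[xc + ρ, xe]`, at a time `t` with
`xe ≤ xc + ρ + |t|` the exterior energy `∫_{ρ+|t|<|x−xc|} e(t, x) dx` is the energy on a part of
`(xe, ∞)` (the near half-line `x < xc − ρ − |t|` carries nothing), hence it is bounded by any bound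
`b` on `∫_{(xe, ∞)} e(t, x) dx`. -/
theorem exteriorEnergy_le_of_far {V : ℝ → ℝ} {ψ : ℝ → ℝ → ℝ} {xc ρ xe t b : ℝ} (hρ : 0 ≤ ρ)
    (hedge : xe ≤ xc + ρ + |t|) (hψ2 : ContDiff ℝ 2 (uncurry ψ))
    (hsupp : ∀ s x, (x < (xc + ρ) - |s| ∨ xe + |s| < x) → ψ s x = 0)
    (he0 : ∀ x, 0 ≤ deriv (fun τ => ψ τ x) t ^ 2 + deriv (ψ t) x ^ 2 + V x * ψ t x ^ 2)
    (hInt : Integrable fun x => deriv (fun τ => ψ τ x) t ^ 2 + deriv (ψ t) x ^ 2 + V x * ψ t x ^ 2)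
    (hb : ∫ x in Ioi xe, (deriv (fun τ => ψ τ x) t ^ 2 + deriv (ψ t) x ^ 2 + V x * ψ t x ^ 2) ≤ b) :
    exteriorEnergy V xc ρ ψ t ≤ ENNReal.ofReal b := by
  unfold exteriorEnergy
  have hd : 0 ≤ ρ + |t| := add_nonneg hρ (abs_nonneg t)
  rw [WaveEnergy.lintegral_setOf_lt_abs_sub xc hd]
  -- the near half-line carries no energy
  have hnear : ∫⁻ x in Iio (xc - (ρ + |t|)), ENNReal.ofReal (energyDensity V ψ t x) = 0 := by
    refine setLIntegral_eq_zero measurableSet_Iio fun x hx => ?_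
    simp only [mem_Iio] at hx
    have hx' : x < (xc + ρ) - |t| ∨ xe + |t| < x := Or.inl (by linarith)
    show ENNReal.ofReal (energyDensity V ψ t x) = 0
    unfold energyDensity
    rw [energyDensity_eq_zero_of_exterior hψ2 hsupp hx', ENNReal.ofReal_zero]
  rw [hnear, zero_add]
  -- the far half-line lies beyond `xe`
  have hsub : Ioi (xc + (ρ + |t|)) ⊆ Ioi xe := fun x hx => by
    simp only [mem_Ioi] at hx ⊢
    linarith
  refine (lintegral_mono_set hsub).trans ?_
  unfold energyDensity
  rw [← ofReal_integral_eq_lintegral_ofReal hInt.integrableOn (Eventually.of_forall he0)]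
  exact ENNReal.ofReal_le_ofReal hb

open Summit.FinalStateConjecture.FinalStateConjecture.Theorems.Blindness in
/-- **Far-edge frozen packets have arbitrarily small two-ended channel energy** (negative-side
support for K1R, item stmt-FinalStateConjecture-14074; this seat).  For every tortoise radius
function, every ball radius `ρ ≥ 0` and every `ε > 0`, for ALL sufficiently large `m`, the spin-2
mode `ℓ = m⁴` carries a velocity packet `(0, g)`, `g ≠ 0`, supported in `[xc + ρ, xc + ρ + 3/m³]`
(flush inside the FAR edge of the cone `{ρ + |t| < |x − xc|}`), whose global Regge–Wheeler
solution radiates at most `ε ∫ g²` through the forward channel ends and at most `ε ∫ g²` through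
the backward ones.  Hence ANY channel inequality at `(ρ, ℓ)` with constant `c` forces the kernel
deficit of these packets below `(2ε/c) ∫ g²`: on the far side the `t`-polynomial kernel must
absorb edge rest packets (its velocity towers are nonzero, unlike the near side where this
packet family refuted K1).  The edge `xc + ρ` is arbitrary: the log-ball of K1R only delays the
family to larger `m` (see `farAbsorption_of_uniformR` in the crux Disproof file). -/
theorem far_frozen_channel_small {M : ℝ} {r : ℝ → ℝ} {xc : ℝ} (hr : IsTortoiseRadius M r xc)
    {ρ : ℝ} (hρ : 0 ≤ ρ) {ε : ℝ} (hε : 0 < ε) :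
    ∃ m₀ : ℕ, 2 ≤ m₀ ∧ ∀ m : ℕ, m₀ ≤ m →
      ∃ (g : ℝ → ℝ) (T : ℝ), T = 3 / (m : ℝ) ^ 3 ∧ ContDiff ℝ 2 g ∧
        (∀ x, x ∉ Icc (xc + ρ) (xc + ρ + T) → g x = 0) ∧ Integrable (fun x => g x ^ 2) ∧
        0 < ∫ x, g x ^ 2 ∧
        ∃ ψ : ℝ → ℝ → ℝ, IsRWSolution M 2 (m ^ 4) r ψ ∧ (∀ x, ψ 0 x = 0) ∧
          (∀ x, deriv (fun τ => ψ τ x) 0 = g x) ∧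
          (∀ t x, (x < xc + ρ - |t| ∨ xc + ρ + T + |t| < x) → ψ t x = 0) ∧
          channelEnergy (linePotential M 2 (m ^ 4) r) xc ρ ψ atTop
              ≤ ENNReal.ofReal (ε * ∫ x, g x ^ 2) ∧
          channelEnergy (linePotential M 2 (m ^ 4) r) xc ρ ψ atBot
              ≤ ENNReal.ofReal (ε * ∫ x, g x ^ 2) := by
  have hM := hr.mass_pos
  set e : ℝ := xc + ρ with he_def
  -- the bump and the constants of the potential on `[e − 3, e + 3]`
  obtain ⟨B, hB, h0l, h0r, h1, h01, K₂, hK₂, hB2⟩ := exists_profile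
  obtain ⟨f₀, C₀, C₁, hf₀, hC₀, hC₁, hKV⟩ :=
    potential_compact_bounds hM hr.two_mul_lt hr.hasDerivAt (a := e - 3) (b := e + 3) (by linarith)
  obtain ⟨m₁, hm₁⟩ := exists_nat_gt (max 2
    (max (2 * C₀ / f₀) (Real.sqrt (108 * (9 * C₁ + K₂) ^ 2 / (ε * f₀)))))
  refine ⟨m₁, ?_, fun m hm => ?_⟩
  · have : (2 : ℝ) < m₁ := lt_of_le_of_lt (le_max_left _ _) hm₁
    have : (2 : ℕ) < m₁ := by exact_mod_cast this
    omega
  have hmr : (m₁ : ℝ) ≤ m := by exact_mod_cast hm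
  have hm2r : (2 : ℝ) < m := lt_of_lt_of_le (lt_of_le_of_lt (le_max_left _ _) hm₁) hmr
  have hm2 : 2 ≤ m := by
    have : (2 : ℕ) < m := by exact_mod_cast hm2r
    omega
  have hm0 : (0 : ℝ) < m := by linarith
  have hm1 : (1 : ℝ) ≤ m := by linarith
  have hmC : 2 * C₀ / f₀ ≤ m :=
    ((lt_of_le_of_lt ((le_max_left _ _).trans (le_max_right _ _)) hm₁).le).trans hmr
  have hmε : 108 * (9 * C₁ + K₂) ^ 2 / (ε * f₀) ≤ (m : ℝ) ^ 2 := by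
    have h := lt_of_le_of_lt ((le_max_right _ _).trans (le_max_right _ _)) hm₁
    have h' : Real.sqrt (108 * (9 * C₁ + K₂) ^ 2 / (ε * f₀)) < m := lt_of_lt_of_le h hmr
    exact ((Real.sqrt_lt' hm0).1 h').le
  have hℓ2 : 2 ≤ m ^ 4 := le_trans hm2 (Nat.le_self_pow (by norm_num) m)
  -- the right end of the packet
  set xe : ℝ := e + 3 / (m : ℝ) ^ 3 with hxe_def
  have h3 : 0 < 3 / (m : ℝ) ^ 3 := by positivity
  have h3' : 3 / (m : ℝ) ^ 3 ≤ 3 := by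
    rw [div_le_iff₀ (by positivity)]
    have : (1 : ℝ) ≤ (m : ℝ) ^ 3 := one_le_pow₀ hm1
    nlinarith
  have hsubK : Icc (xe - 3) xe ⊆ Icc (e - 3) (e + 3) := by
    intro x hx
    exact ⟨by linarith [hx.1], by linarith [hx.2]⟩
  -- the packet
  obtain ⟨g, α, T, hg2, -, hT0, ⟨hαeq, hTeq⟩, -, hgoff, -, hgint, hgpos, ψ, hψ2, hsol, hψ0, hψ1,
      hsupp, he0, hInt, hplus, hminus⟩ :=
    frozen_packet_far hM hr.two_mul_lt hr.hasDerivAt xe hε hB h0l h0r h1 h01 hK₂ hB2 hf₀ hC₁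
      (fun ℓ x hx => (hKV ℓ).1 x (hsubK hx))
      (fun ℓ x hx y hy => (hKV ℓ).2 x (hsubK hx) y (hsubK hy)) hm2 hmC hmε (m ^ 4) rfl
      (linePotential M 2 (m ^ 4) r) rfl
  have hαe : α = e := by rw [hαeq, hTeq, hxe_def]; ring
  have hxeT : xe = e + T := by rw [hTeq, hxe_def]
  have hψsol : IsRWSolution M 2 (m ^ 4) r ψ := ⟨hψ2, fun z => hsol z.1 z.2⟩
  refine ⟨g, T, hTeq, hg2, ?_, hgint, hgpos, ψ, hψsol, hψ0, hψ1, ?_, ?_⟩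
  · intro x hx
    apply hgoff x
    rwa [hαe, hxeT]
  · intro t x hx
    apply hsupp t x
    rwa [hαe, hxeT]
  -- exterior energies at `±T`, then monotonicity
  have hsupp' : ∀ s x, (x < (xc + ρ) - |s| ∨ xe + |s| < x) → ψ s x = 0 := by
    intro s x hx; apply hsupp s x; rwa [hαe]
  have hedgeT : xe ≤ xc + ρ + |T| := by rw [abs_of_pos hT0, hxeT]
  have hedgeT' : xe ≤ xc + ρ + |(-T)| := by rw [abs_neg, abs_of_pos hT0, hxeT]
  have hup := exteriorEnergy_le_of_far hρ hedgeT hψ2 hsupp' (he0 T) (hInt T) hplus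
  have hdown := exteriorEnergy_le_of_far hρ hedgeT' hψ2 hsupp' (he0 (-T)) (hInt (-T)) hminus
  have hmono := RW.exteriorEnergy_antitoneOn_rw hr hℓ2 hψsol xc hρ
  obtain ⟨h1', h2'⟩ := channelEnergy_le_of_antitone' hmono hT0.le
  exact ⟨h1'.trans hup, h2'.trans hdown⟩

end Channel

end Summit.FinalStateConjecture.FinalStateConjecture.Theorems.FrozenPacket

end
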